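import Summits.CriticalPhenomena.Ising3D.Control2DL15TwoSided030
import Summits.CriticalPhenomena.Ising3D.Control2DL15BoxQ
import Summits.CriticalPhenomena.Ising3D.Control2DL15BoxR
import Summits.CriticalPhenomena.Ising3D.Control2DL11BoxA
import Mathlib.Tactic.Linarith
import Mathlib.Tactic.NormNum
import HarnessLib

/-!
# The class-1 2D control WITHOUT a window assumption, in the kernel: `0.95 < Δ_ε < 1.0006` at `Δ_σ = 1/8` under `A2D′`
(cell `pub-ising3x`, seat controls-1 gen 18; KERNEL PATH for the 2D γ-certificates, Λ ≤ 15 class-1 cover — CONTROL-ONLY)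

HONEST FRAMING: lottery ticket; floor = tightest certified 3D Ising CFT bounds; no exact-solution
claim without a proof. CONTROL-ONLY (`d = 2`, `Δ_σ = 1/8`, axiom set `A2D′`); nothing about `d = 3`; weaker than the
reader-certified statement of record (`0.99 < Δ_ε < 1.00005`, Λ = 19, readers A ∧ B).

The two remaining RB-4 Λ = 15 / E₀ = 40 kind-`box` certificates of `j129649` — R `[4/25, 11/50]` and Q `[11/50, 3/10]`
(kernel-complete: `Control2DL15BoxR`, `Control2DL15BoxQ`) — close the gap between g16's Λ = 11 box A `[0, 4/25]`
(`Control2DL11BoxA`) and the Λ ≤ 15 cover `excludedOn_2d_L15_cover030`: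
* `excludedOn_2d_cover_noWindow : ExcludedOn (1/8) 2 1 (Icc 0 (19/20))`;
* `twoSided_2d_kernel_noWindow : TwoSided (1/8) 2 1 0 (19/20) (5003/5000)` — under `A2D′` at `Δ_σ = 1/8` EVERY `ε`
  location `x ≥ 0` lies in `(0.95, 1.0006)` (2D Ising: `Δ_ε = 1`): the window hypothesis of the Λ ≤ 13 kernel statements
  is gone (the reader-certified statement of record dropped it at RB-4, `cover_v11.json`); everything rests on the Lean
  kernel alone;
* `twoSided_2d_kernel_all (w) : TwoSided (1/8) 2 1 w (19/20) (5003/5000)` for EVERY real `w` — locations `x < 0` carry no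
  scalar of a unitary datum (`Δ ≥ ℓ = 0`), so they are excluded by the gap certificate alone (`excludedAt_of_neg`,
  `twoSided_of_cover_zero`: the elementary logic, proved here). No facts, standard axioms only.
-/

namespace Summit.CriticalPhenomena.Ising3D.Control2D

open Set
open Literature.MathematicalPhysics.QuantumFieldTheory.ConformalBootstrap3D

/-- **Negative locations are excluded by unitarity alone** (plus the gap certificate for the remaining scalars):
if `x < 0`, a unitary datum has no scalar at `x` (`Δ ≥ ℓ = 0`), so `ScalarsIn ({x} ∪ [G, ∞))` forces the scalar gap
`G ≥ U`, excluded by `GapExcluded s U`. Elementary. [folklore] -/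
theorem excludedAt_of_neg {s G δ U x : ℝ} (h : GapExcluded s U) (hUG : U ≤ G) (hx : x < 0) :
    ExcludedAt s G δ x := by
  intro D hU hC hS _hT
  refine h D hU hC ?_
  intro i hi
  rcases hS i hi with hmem | hmem
  · exfalso
    rw [mem_singleton_iff] at hmem
    have h1 : (D.spin i : ℝ) ≤ D.Δ i := (hU i).2.1
    have h2 : (0 : ℝ) ≤ (D.spin i : ℝ) := Nat.cast_nonneg _
    linarith
  · exact hUG.trans hmem

/-- **The class-1 item with NO window at all**: a cover of the locations `[0, ε_lo]` plus the gap certificate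
(`U ≤ G`) give `TwoSided s G δ w ε_lo U` for EVERY `w` (locations `x < 0` by `excludedAt_of_neg`). Elementary.
[folklore] -/
theorem twoSided_of_cover_zero {s G δ εlo U : ℝ} (hcov : ExcludedOn s G δ (Icc 0 εlo))
    (hgap : GapExcluded s U) (hUG : U ≤ G) (w : ℝ) : TwoSided s G δ w εlo U := by
  intro D hU hC hT x _hwx hS
  constructor
  · rcases lt_or_ge εlo x with hlt | hle
    · exact hlt
    · rcases lt_or_ge x 0 with hx0 | hx0
      · exact (excludedAt_of_neg hgap hUG hx0 D hU hC hS hT).elim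
      · exact (hcov x ⟨hx0, hle⟩ D hU hC hS hT).elim
  · rcases lt_or_ge x U with hlt | hle
    · exact hlt
    · exact (excludedAt_of_gapExcluded hgap hUG hle D hU hC hS hT).elim

/-- Kernel-complete cover of the `ε` locations `[11/50, 19/20]` (box Q prepended). CONTROL-ONLY (d = 2).
[cite: RattazziEtAl2008, §5.5] -/
theorem excludedOn_2d_L15_cover022 : ExcludedOn (1 / 8 : ℝ) 2 1 (Icc (11 / 50 : ℝ) (19 / 20)) :=
  excludedOn_Icc_append excludedOn_2d_L15_boxQ excludedOn_2d_L15_cover030 le_rfl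

/-- Kernel-complete cover of the `ε` locations `[4/25, 19/20]` (box R prepended). CONTROL-ONLY (d = 2).
[cite: RattazziEtAl2008, §5.5] -/
theorem excludedOn_2d_L15_cover016 : ExcludedOn (1 / 8 : ℝ) 2 1 (Icc (4 / 25 : ℝ) (19 / 20)) :=
  excludedOn_Icc_append excludedOn_2d_L15_boxR excludedOn_2d_L15_cover022 le_rfl

/-- **Kernel-complete cover of ALL `ε` locations `[0, 19/20]`** at `Δ_σ = 1/8` under `A2D′` (Λ = 11 box A, Λ = 15
boxes R, Q, P, Λ = 11 boxes B–J, Λ = 13 boxes K–O). CONTROL-ONLY (d = 2). [cite: RattazziEtAl2008, §5.5] -/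
theorem excludedOn_2d_cover_noWindow : ExcludedOn (1 / 8 : ℝ) 2 1 (Icc (0 : ℝ) (19 / 20)) :=
  excludedOn_Icc_append excludedOn_2d_L11_boxA excludedOn_2d_L15_cover016 le_rfl

/-- **2D control, class 1, kernel-complete, NO WINDOW (Λ ≤ 15, E₀ ≤ 40)**: under `A2D′` at `Δ_σ = 1/8` every `ε`
location `x ≥ 0` satisfies `19/20 < x < 5003/5000`. CONTROL-ONLY (d = 2). [cite: RattazziEtAl2008, §5.5] -/
theorem twoSided_2d_kernel_noWindow : TwoSided (1 / 8 : ℝ) 2 1 0 (19 / 20) (5003 / 5000) :=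
  twoSided_of_cover excludedOn_2d_cover_noWindow gapExcluded_2d_L11_gapA (by norm_num)

/-- **2D control, class 1, kernel-complete, for EVERY window parameter `w`** (Λ ≤ 15, E₀ ≤ 40): under `A2D′` at
`Δ_σ = 1/8` the `ε` location satisfies `19/20 < Δ_ε < 5003/5000`, whatever lower window is assumed (none is needed).
CONTROL-ONLY (d = 2). [cite: RattazziEtAl2008, §5.5] -/
theorem twoSided_2d_kernel_all (w : ℝ) : TwoSided (1 / 8 : ℝ) 2 1 w (19 / 20) (5003 / 5000) :=
  twoSided_of_cover_zero excludedOn_2d_cover_noWindow gapExcluded_2d_L11_gapA (by norm_num) w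

end Summit.CriticalPhenomena.Ising3D.Control2D
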